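import Mathlib
import Summits.KontsevichZagierPeriods.Zeta5Search.TS3RayCasLB
import Summits.KontsevichZagierPeriods.Zeta5Search.DenomLaw.TS3RayCStar
import Summits.KontsevichZagierPeriods.Zeta5Search.DenomLaw.PathWeightBounds
import Summits.KontsevichZagierPeriods.Zeta5Search.DenomLaw.RuleR
import Summits.KontsevichZagierPeriods.Zeta5Search.VCarrierAggregate
import HarnessLib

/-!
# ζ(5) search — the PATH ACCOUNTING node on TOP_STAIR #3: `PathAccountingFirstPeriod`'s conclusion for `b(n)`, EVERY first-period prime, every `j`, all `n`

Cell `pub-zeta5` (HONEST FRAMING: systematic search; no irrationality claim unless certified), TRACK «DENOM-LAW» D1 prover seat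
(denom-prover-d1 g14, `HOME/denom-law/prover-d1/ATTEMPT-14.md` §3).  The typed D2 node `DenomLaw.PathAccountingFirstPeriod` (Brown–Zudilin (28)+(30)
transported by `G ≅ S₇`, in Casoratian form: `v_p(Cas₇) ≥ ⌊d/p⌋ − N_p − min([⌊d/p⌋ ≥ 2], 5 − C⋆)`) is proved here ON TOP_STAIR #3 = the census direction
`a = (18,32,23,30,28,38,43,30)` (the TOP_STAIR ray with the largest staircase saving, `δ_28 = 195` vs `δ_stair = 191`), dual ray
`b(n) = n·(85; 35,32,30,27,25,22,20) = bRay ts3 n` (`b₀ = 85n`, `d = 64n`), for every `n ≥ 1`, EVERY direction `j` and EVERY first-period prime (on the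
ray the 28 forms are `< 2p` iff `2p > 43n`):
* §1 the integer data on the ray for `2p > 43n`: `⌊d/p⌋ ∈ {2,1,0}` (`p ≤ 32n`, `32n < p ≤ 64n`, `p > 64n`), `refund`, and the closed form of `N_p`
  (`pairFloors_ts3`: `2[p≤23n] + [p≤25n] + [p≤26n] + 3[p≤28n] + 2[p≤30n] + [p≤31n] + 3[p≤33n] + [p≤35n] + [p≤36n] + 2[p≤38n] + [p≤40n] + [p≤43n]`);
* §2 the THEOREM-V cell `40n < p ≤ 41n` (`N_p = 1`, `v(V), v(V⁺) ≥ −1` by `padicNorm_coeffV_le_pairFloors`, rows `≥ 1` from the cover: `v ≥ 0 = casLB + 1`);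
* §3 the assembly `pathAccounting_ts3`: `2p ≤ 64n` (`⌊d/p⌋ = 2`): cells `(21.5,23], (23,25], (25,26], (26,28], (28,85/3]` by `casLB = −11, −9, −9, −9, −7` with
  `C⋆ ≤ 11, 11, 10, 9, 8`; `(85/3,30]`, `(30,31]` by the DOUBLE DROP (`v ≥ −7`, `C⋆ ≤ 8, 6`); `(31,32]` by the COLLINEARITY RUNG (`v ≥ −6`, `C⋆ ≤ 6`);
  `32n < p ≤ 64n` (`⌊d/p⌋ = 1`, `C⋆ ≤ 5`): `(32,33] −7 ≥ −8`, `(33,35] −5`, `(35,36] −4` (Lemma D; the STAIR cell of `StairCellTS3b`), `(36,38] −3` (the STAIR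
  cell of `StairCellTS3a`), `(38,40] −1`, `(40,41] 0` (THEOREM V), `(41,43] 0`, `(43,64] 1`; `p > 64n` (`⌊d/p⌋ = 0`): value `≤ 0`, `casLB ≥ 0` / the tree's
  `casoratianValuationLaw_above` beyond `85n`.  Then `fortythree_lt_of_firstPeriod`, `pathAccountingFirstPeriod_ts3` (every `j`) and
  **`pathAccountingFirstPeriod_on_ts3`** (the node's binders VERBATIM with `b := b(n)`), and the (CV) corollary `ts3RayCV_gt43` (every `j`, every prime `2p > 43n`).
So after the record ray (g11), the flag ray (g12) and TOP_STAIR #1 (g13), the PATH node is a theorem for every `n` on a fourth census ray; the ∀-`b` node stays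
OPEN.  MODEL/structure-side valuation bookkeeping of the cell's own rationals; nothing about ζ(5); no γ; records in print UNMOVED.
-/

open Finset

namespace Summit.KontsevichZagierPeriods.Zeta5Search.StairTS3

open Summit.KontsevichZagierPeriods.Zeta5Search.ClusterValuation
open Summit.KontsevichZagierPeriods.Zeta5Search.CasoratianValuation (InPolytope shift casoratian pairFloors refund)
open Summit.KontsevichZagierPeriods.Zeta5Search.WedgeDictionary (dOf coeffV)
open Summit.KontsevichZagierPeriods.Zeta5Search.ClassTypeCover
open Summit.KontsevichZagierPeriods.Zeta5Search.StaircaseCells (bRay ts3)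
open Summit.KontsevichZagierPeriods.Zeta5Search.DenomLaw (cStar FirstPeriod Sorted7)
open Summit.KontsevichZagierPeriods.Zeta5Search.DenomLaw.FirstPeriodKit (cStar_le_eleven)
open Summit.KontsevichZagierPeriods.Zeta5Search.PadicSeries (one_le_p)
open Summit.KontsevichZagierPeriods.Zeta5Search.ClusterValuation.VCarrier (cas_val_ge_of_coeffV)
open Summit.KontsevichZagierPeriods.Zeta5Search.BigPrime (casoratianValuationLaw_above)

/-! ## §1 `⌊d/p⌋`, the refund and `N_p` on the ray (`2p > 43n`) -/

section Arith
variable {n p : ℕ}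

/-- `refund = 1` for `p ≤ 64n = d`. -/
theorem refund_ts3_one (hp0 : 0 < p) (h : p ≤ 64 * n) : refund (bRay ts3 n) p = 1 := by
  unfold refund; rw [dOf_ts3]; apply min_eq_left
  rw [Int.le_ediv_iff_mul_le (by exact_mod_cast hp0)]; nlinarith

/-- `refund = 0` for `p > 64n`. -/
theorem refund_ts3_zero (h : 64 * n < p) : refund (bRay ts3 n) p = 0 := by
  unfold refund
  rw [dOf_ts3, Int.ediv_eq_zero_of_lt (by positivity) (by exact_mod_cast (show 64 * n < p by omega))]; norm_num

/-- `⌊d/p⌋ = 2` for `64n < 3p`, `p ≤ 32n`. -/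
theorem dOf_ts3_div_two (h1 : 64 * n < 3 * p) (h2 : p ≤ 32 * n) : dOf (bRay ts3 n) / (p : ℤ) = 2 := by
  have hp0 : (0 : ℤ) < p := by exact_mod_cast (show 0 < p by omega)
  have h1' : (64 * n : ℤ) < 3 * p := by exact_mod_cast h1
  have h2' : (p : ℤ) ≤ 32 * n := by exact_mod_cast h2
  rw [dOf_ts3]
  apply le_antisymm
  · have : (64 * (n : ℤ)) / (p : ℤ) < 3 := by rw [Int.ediv_lt_iff_lt_mul hp0]; linarith
    omega
  · rw [Int.le_ediv_iff_mul_le hp0]; linarith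

/-- `⌊d/p⌋ = 1` for `32n < p ≤ 64n`. -/
theorem dOf_ts3_div_one (h1 : 32 * n < p) (h2 : p ≤ 64 * n) : dOf (bRay ts3 n) / (p : ℤ) = 1 := by
  have hp0 : (0 : ℤ) < p := by exact_mod_cast (show 0 < p by omega)
  have h1' : (32 * n : ℤ) < p := by exact_mod_cast h1
  have h2' : (p : ℤ) ≤ 64 * n := by exact_mod_cast h2
  rw [dOf_ts3]
  apply le_antisymm
  · have : (64 * (n : ℤ)) / (p : ℤ) < 2 := by rw [Int.ediv_lt_iff_lt_mul hp0]; linarith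
    omega
  · rw [Int.le_ediv_iff_mul_le hp0]; linarith

/-- `⌊d/p⌋ = 0` for `p > 64n`. -/
theorem dOf_ts3_div_zero (h : 64 * n < p) : dOf (bRay ts3 n) / (p : ℤ) = 0 := by
  rw [dOf_ts3]; exact Int.ediv_eq_zero_of_lt (by positivity) (by exact_mod_cast (show 64 * n < p by omega))

/-- **`N_p` on the first-period ray** (`2p > 43n`; the 21 pair blocks are `(85 − c_i − c_k)·n ∈ {18,20,23,23,25,26,28,28,28,30,30,31,33,33,33,35,36,38,38,40,43}·n`,
each `< 2p`, the two shortest `< p`):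
`N_p = 2[p≤23n] + [p≤25n] + [p≤26n] + 3[p≤28n] + 2[p≤30n] + [p≤31n] + 3[p≤33n] + [p≤35n] + [p≤36n] + 2[p≤38n] + [p≤40n] + [p≤43n]`. -/
theorem pairFloors_ts3 (hp : 43 * n < 2 * p) :
    pairFloors (bRay ts3 n) p =
      2 * (if p ≤ 23 * n then 1 else 0) + (if p ≤ 25 * n then 1 else 0) + (if p ≤ 26 * n then 1 else 0) +
      3 * (if p ≤ 28 * n then 1 else 0) + 2 * (if p ≤ 30 * n then 1 else 0) + (if p ≤ 31 * n then 1 else 0) +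
      3 * (if p ≤ 33 * n then 1 else 0) + (if p ≤ 35 * n then 1 else 0) + (if p ≤ 36 * n then 1 else 0) +
      2 * (if p ≤ 38 * n then 1 else 0) + (if p ≤ 40 * n then 1 else 0) + (if p ≤ 43 * n then 1 else 0) := by
  have hp0 : (0 : ℤ) < p := by exact_mod_cast (show 0 < p by omega)
  have hq0 : ∀ (a b : ℤ) (c : ℕ), (85 : ℤ) - a - b = c → c * n < p →
      ((85 : ℤ) * n - a * n - b * n) / (p : ℤ) = 0 := by
    intro a b c h h2
    rw [show (85 : ℤ) * n - a * n - b * n = (c : ℤ) * n by rw [← h]; ring]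
    exact Int.ediv_eq_zero_of_lt (by positivity) (by exact_mod_cast h2)
  have hq1 : ∀ (a b : ℤ) (c : ℕ), (85 : ℤ) - a - b = c → c * n < 2 * p →
      ((85 : ℤ) * n - a * n - b * n) / (p : ℤ) = if p ≤ c * n then 1 else 0 := by
    intro a b c h h2
    rw [show (85 : ℤ) * n - a * n - b * n = (c : ℤ) * n by rw [← h]; ring]
    have h2' : ((c * n : ℕ) : ℤ) < 2 * p := by exact_mod_cast h2
    push_cast at h2'
    split_ifs with hc
    · have hc' : (p : ℤ) ≤ c * n := by exact_mod_cast hc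
      rw [Int.ediv_eq_iff_of_pos hp0]; constructor <;> linarith
    · push Not at hc
      have hc' : (c : ℤ) * n < p := by exact_mod_cast hc
      exact Int.ediv_eq_zero_of_lt (by positivity) hc'
  suffices hR : ∀ R : ℤ,
      2 * (if p ≤ 23 * n then 1 else 0) + (if p ≤ 25 * n then 1 else 0) + (if p ≤ 26 * n then 1 else 0) +
      3 * (if p ≤ 28 * n then 1 else 0) + 2 * (if p ≤ 30 * n then 1 else 0) + (if p ≤ 31 * n then 1 else 0) +
      3 * (if p ≤ 33 * n then 1 else 0) + (if p ≤ 35 * n then 1 else 0) + (if p ≤ 36 * n then 1 else 0) +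
      2 * (if p ≤ 38 * n then 1 else 0) + (if p ≤ 40 * n then 1 else 0) + (if p ≤ 43 * n then 1 else 0) = R →
      pairFloors (bRay ts3 n) p = R from hR _ rfl
  intro R hR
  unfold pairFloors
  simp only [sum_range_succ, sum_range_zero, zero_add, Nat.reduceAdd, w0, w1, w2, w3, w4, w5, w6, w7, Nat.lt_irrefl, if_false,
    show (0:ℕ) < 1 by norm_num, show (0:ℕ) < 2 by norm_num, show (0:ℕ) < 3 by norm_num, show (0:ℕ) < 4 by norm_num, show (0:ℕ) < 5 by norm_num,
    show (0:ℕ) < 6 by norm_num, show (1:ℕ) < 2 by norm_num, show (1:ℕ) < 3 by norm_num, show (1:ℕ) < 4 by norm_num, show (1:ℕ) < 5 by norm_num,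
    show (1:ℕ) < 6 by norm_num, show (2:ℕ) < 3 by norm_num, show (2:ℕ) < 4 by norm_num, show (2:ℕ) < 5 by norm_num, show (2:ℕ) < 6 by norm_num,
    show (3:ℕ) < 4 by norm_num, show (3:ℕ) < 5 by norm_num, show (3:ℕ) < 6 by norm_num, show (4:ℕ) < 5 by norm_num, show (4:ℕ) < 6 by norm_num,
    show (5:ℕ) < 6 by norm_num, if_true,
    show ¬ (1:ℕ) < 0 by norm_num, show ¬ (2:ℕ) < 0 by norm_num, show ¬ (3:ℕ) < 0 by norm_num, show ¬ (4:ℕ) < 0 by norm_num, show ¬ (5:ℕ) < 0 by norm_num,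
    show ¬ (6:ℕ) < 0 by norm_num, show ¬ (2:ℕ) < 1 by norm_num, show ¬ (3:ℕ) < 1 by norm_num, show ¬ (4:ℕ) < 1 by norm_num, show ¬ (5:ℕ) < 1 by norm_num,
    show ¬ (6:ℕ) < 1 by norm_num, show ¬ (3:ℕ) < 2 by norm_num, show ¬ (4:ℕ) < 2 by norm_num, show ¬ (5:ℕ) < 2 by norm_num, show ¬ (6:ℕ) < 2 by norm_num,
    show ¬ (4:ℕ) < 3 by norm_num, show ¬ (5:ℕ) < 3 by norm_num, show ¬ (6:ℕ) < 3 by norm_num, show ¬ (5:ℕ) < 4 by norm_num, show ¬ (6:ℕ) < 4 by norm_num,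
    show ¬ (6:ℕ) < 5 by norm_num, add_zero]
  rw [hq0 35 32 18 (by norm_num) (by omega), hq0 35 30 20 (by norm_num) (by omega),
      hq1 35 27 23 (by norm_num) (by omega), hq1 35 25 25 (by norm_num) (by omega), hq1 35 22 28 (by norm_num) (by omega),
      hq1 35 20 30 (by norm_num) (by omega), hq1 32 30 23 (by norm_num) (by omega), hq1 32 27 26 (by norm_num) (by omega),
      hq1 32 25 28 (by norm_num) (by omega), hq1 32 22 31 (by norm_num) (by omega), hq1 32 20 33 (by norm_num) (by omega),
      hq1 30 27 28 (by norm_num) (by omega), hq1 30 25 30 (by norm_num) (by omega), hq1 30 22 33 (by norm_num) (by omega),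
      hq1 30 20 35 (by norm_num) (by omega), hq1 27 25 33 (by norm_num) (by omega), hq1 27 22 36 (by norm_num) (by omega),
      hq1 27 20 38 (by norm_num) (by omega), hq1 25 22 38 (by norm_num) (by omega), hq1 25 20 40 (by norm_num) (by omega),
      hq1 22 20 43 (by norm_num) (by omega), ← hR]
  ring

/-- `N_p = 19` on `43n < 2p`, `p ≤ 23n`. -/
theorem N_c21 (hA : 43 * n < 2 * p) (hB : p ≤ 23 * n) : pairFloors (bRay ts3 n) p = 19 := by
  rw [pairFloors_ts3 hA]; simp only [show p ≤ 23 * n from hB, show p ≤ 25 * n by omega, show p ≤ 26 * n by omega, show p ≤ 28 * n by omega,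
    show p ≤ 30 * n by omega, show p ≤ 31 * n by omega, show p ≤ 33 * n by omega, show p ≤ 35 * n by omega, show p ≤ 36 * n by omega,
    show p ≤ 38 * n by omega, show p ≤ 40 * n by omega, show p ≤ 43 * n by omega, if_true]; norm_num
/-- `N_p = 17` on `23n < p ≤ 25n`. -/
theorem N_c23 (hA : 23 * n < p) (hB : p ≤ 25 * n) : pairFloors (bRay ts3 n) p = 17 := by
  rw [pairFloors_ts3 (n := n) (p := p) (by omega)]; simp only [show ¬ p ≤ 23 * n by omega, show p ≤ 25 * n from hB, show p ≤ 26 * n by omega, show p ≤ 28 * n by omega,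
    show p ≤ 30 * n by omega, show p ≤ 31 * n by omega, show p ≤ 33 * n by omega, show p ≤ 35 * n by omega, show p ≤ 36 * n by omega,
    show p ≤ 38 * n by omega, show p ≤ 40 * n by omega, show p ≤ 43 * n by omega, if_true, if_false]; norm_num
/-- `N_p = 16` on `25n < p ≤ 26n`. -/
theorem N_c25 (hA : 25 * n < p) (hB : p ≤ 26 * n) : pairFloors (bRay ts3 n) p = 16 := by
  rw [pairFloors_ts3 (n := n) (p := p) (by omega)]; simp only [show ¬ p ≤ 23 * n by omega, show ¬ p ≤ 25 * n by omega, show p ≤ 26 * n from hB, show p ≤ 28 * n by omega,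
    show p ≤ 30 * n by omega, show p ≤ 31 * n by omega, show p ≤ 33 * n by omega, show p ≤ 35 * n by omega, show p ≤ 36 * n by omega,
    show p ≤ 38 * n by omega, show p ≤ 40 * n by omega, show p ≤ 43 * n by omega, if_true, if_false]; norm_num
/-- `N_p = 15` on `26n < p ≤ 28n`. -/
theorem N_c26 (hA : 26 * n < p) (hB : p ≤ 28 * n) : pairFloors (bRay ts3 n) p = 15 := by
  rw [pairFloors_ts3 (n := n) (p := p) (by omega)]; simp only [show ¬ p ≤ 23 * n by omega, show ¬ p ≤ 25 * n by omega, show ¬ p ≤ 26 * n by omega, show p ≤ 28 * n from hB,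
    show p ≤ 30 * n by omega, show p ≤ 31 * n by omega, show p ≤ 33 * n by omega, show p ≤ 35 * n by omega, show p ≤ 36 * n by omega,
    show p ≤ 38 * n by omega, show p ≤ 40 * n by omega, show p ≤ 43 * n by omega, if_true, if_false]; norm_num
/-- `N_p = 12` on `28n < p ≤ 30n`. -/
theorem N_c28 (hA : 28 * n < p) (hB : p ≤ 30 * n) : pairFloors (bRay ts3 n) p = 12 := by
  rw [pairFloors_ts3 (n := n) (p := p) (by omega)]; simp only [show ¬ p ≤ 23 * n by omega, show ¬ p ≤ 25 * n by omega, show ¬ p ≤ 26 * n by omega, show ¬ p ≤ 28 * n by omega,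
    show p ≤ 30 * n from hB, show p ≤ 31 * n by omega, show p ≤ 33 * n by omega, show p ≤ 35 * n by omega, show p ≤ 36 * n by omega,
    show p ≤ 38 * n by omega, show p ≤ 40 * n by omega, show p ≤ 43 * n by omega, if_true, if_false]; norm_num
/-- `N_p = 10` on `30n < p ≤ 31n`. -/
theorem N_c30 (hA : 30 * n < p) (hB : p ≤ 31 * n) : pairFloors (bRay ts3 n) p = 10 := by
  rw [pairFloors_ts3 (n := n) (p := p) (by omega)]; simp only [show ¬ p ≤ 23 * n by omega, show ¬ p ≤ 25 * n by omega, show ¬ p ≤ 26 * n by omega, show ¬ p ≤ 28 * n by omega,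
    show ¬ p ≤ 30 * n by omega, show p ≤ 31 * n from hB, show p ≤ 33 * n by omega, show p ≤ 35 * n by omega, show p ≤ 36 * n by omega,
    show p ≤ 38 * n by omega, show p ≤ 40 * n by omega, show p ≤ 43 * n by omega, if_true, if_false]; norm_num
/-- `N_p = 9` on `31n < p ≤ 33n`. -/
theorem N_c31 (hA : 31 * n < p) (hB : p ≤ 33 * n) : pairFloors (bRay ts3 n) p = 9 := by
  rw [pairFloors_ts3 (n := n) (p := p) (by omega)]; simp only [show ¬ p ≤ 23 * n by omega, show ¬ p ≤ 25 * n by omega, show ¬ p ≤ 26 * n by omega, show ¬ p ≤ 28 * n by omega,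
    show ¬ p ≤ 30 * n by omega, show ¬ p ≤ 31 * n by omega, show p ≤ 33 * n from hB, show p ≤ 35 * n by omega, show p ≤ 36 * n by omega,
    show p ≤ 38 * n by omega, show p ≤ 40 * n by omega, show p ≤ 43 * n by omega, if_true, if_false]; norm_num
/-- `N_p = 6` on `33n < p ≤ 35n`. -/
theorem N_c33 (hA : 33 * n < p) (hB : p ≤ 35 * n) : pairFloors (bRay ts3 n) p = 6 := by
  rw [pairFloors_ts3 (n := n) (p := p) (by omega)]; simp only [show ¬ p ≤ 23 * n by omega, show ¬ p ≤ 25 * n by omega, show ¬ p ≤ 26 * n by omega, show ¬ p ≤ 28 * n by omega,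
    show ¬ p ≤ 30 * n by omega, show ¬ p ≤ 31 * n by omega, show ¬ p ≤ 33 * n by omega, show p ≤ 35 * n from hB, show p ≤ 36 * n by omega,
    show p ≤ 38 * n by omega, show p ≤ 40 * n by omega, show p ≤ 43 * n by omega, if_true, if_false]; norm_num
/-- `N_p = 5` on `35n < p ≤ 36n`. -/
theorem N_c35 (hA : 35 * n < p) (hB : p ≤ 36 * n) : pairFloors (bRay ts3 n) p = 5 := by
  rw [pairFloors_ts3 (n := n) (p := p) (by omega)]; simp only [show ¬ p ≤ 23 * n by omega, show ¬ p ≤ 25 * n by omega, show ¬ p ≤ 26 * n by omega, show ¬ p ≤ 28 * n by omega,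
    show ¬ p ≤ 30 * n by omega, show ¬ p ≤ 31 * n by omega, show ¬ p ≤ 33 * n by omega, show ¬ p ≤ 35 * n by omega, show p ≤ 36 * n from hB,
    show p ≤ 38 * n by omega, show p ≤ 40 * n by omega, show p ≤ 43 * n by omega, if_true, if_false]; norm_num
/-- `N_p = 4` on `36n < p ≤ 38n`. -/
theorem N_c36 (hA : 36 * n < p) (hB : p ≤ 38 * n) : pairFloors (bRay ts3 n) p = 4 := by
  rw [pairFloors_ts3 (n := n) (p := p) (by omega)]; simp only [show ¬ p ≤ 23 * n by omega, show ¬ p ≤ 25 * n by omega, show ¬ p ≤ 26 * n by omega, show ¬ p ≤ 28 * n by omega,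
    show ¬ p ≤ 30 * n by omega, show ¬ p ≤ 31 * n by omega, show ¬ p ≤ 33 * n by omega, show ¬ p ≤ 35 * n by omega, show ¬ p ≤ 36 * n by omega,
    show p ≤ 38 * n from hB, show p ≤ 40 * n by omega, show p ≤ 43 * n by omega, if_true, if_false]; norm_num
/-- `N_p = 2` on `38n < p ≤ 40n`. -/
theorem N_c38 (hA : 38 * n < p) (hB : p ≤ 40 * n) : pairFloors (bRay ts3 n) p = 2 := by
  rw [pairFloors_ts3 (n := n) (p := p) (by omega)]; simp only [show ¬ p ≤ 23 * n by omega, show ¬ p ≤ 25 * n by omega, show ¬ p ≤ 26 * n by omega, show ¬ p ≤ 28 * n by omega,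
    show ¬ p ≤ 30 * n by omega, show ¬ p ≤ 31 * n by omega, show ¬ p ≤ 33 * n by omega, show ¬ p ≤ 35 * n by omega, show ¬ p ≤ 36 * n by omega,
    show ¬ p ≤ 38 * n by omega, show p ≤ 40 * n from hB, show p ≤ 43 * n by omega, if_true, if_false]; norm_num
/-- `N_p = 1` on `40n < p ≤ 43n`. -/
theorem N_c40 (hA : 40 * n < p) (hB : p ≤ 43 * n) : pairFloors (bRay ts3 n) p = 1 := by
  rw [pairFloors_ts3 (n := n) (p := p) (by omega)]; simp only [show ¬ p ≤ 23 * n by omega, show ¬ p ≤ 25 * n by omega, show ¬ p ≤ 26 * n by omega, show ¬ p ≤ 28 * n by omega,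
    show ¬ p ≤ 30 * n by omega, show ¬ p ≤ 31 * n by omega, show ¬ p ≤ 33 * n by omega, show ¬ p ≤ 35 * n by omega, show ¬ p ≤ 36 * n by omega,
    show ¬ p ≤ 38 * n by omega, show ¬ p ≤ 40 * n by omega, show p ≤ 43 * n from hB, if_true, if_false]; norm_num
/-- `N_p = 0` for `p > 43n`. -/
theorem N_gt43 (hA : 43 * n < p) : pairFloors (bRay ts3 n) p = 0 := by
  rw [pairFloors_ts3 (n := n) (p := p) (by omega)]; simp only [show ¬ p ≤ 23 * n by omega, show ¬ p ≤ 25 * n by omega, show ¬ p ≤ 26 * n by omega, show ¬ p ≤ 28 * n by omega,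
    show ¬ p ≤ 30 * n by omega, show ¬ p ≤ 31 * n by omega, show ¬ p ≤ 33 * n by omega, show ¬ p ≤ 35 * n by omega, show ¬ p ≤ 36 * n by omega,
    show ¬ p ≤ 38 * n by omega, show ¬ p ≤ 40 * n by omega, show ¬ p ≤ 43 * n by omega, if_false]; norm_num

end Arith

/-! ## §2 The THEOREM-V cell `40n < p ≤ 41n` -/

/-- The row condition of THEOREM LB read off a cover: `checkLB` at `(A, B)` gives `B ≤ 3 + E_x` for every multipole class. -/
theorem rows_of_cover {b : ℕ → ℤ} {p : ℕ} [Fact p.Prime] {TY : List (List ℤ × Bool)} (hcov : Cover b p TY) {A B : ℤ}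
    (hchk : checkLB (decide (¬ (2 : ℤ) ∣ b 0)) TY A B = true) :
    ∀ x, x < p → 2 ≤ classPoleCount b p x → B ≤ 3 + classExp b p x := by
  rw [checkLB, List.all_eq_true] at hchk
  intro x hx h2
  obtain ⟨tc, htc, ht⟩ := hcov x hx
  have hc := hchk tc htc
  simp only [Bool.and_eq_true, Bool.or_eq_true, decide_eq_true_eq] at hc
  rw [ht.classPoleCount_eq] at h2
  rw [ht.classExp_eq]
  rcases hc.2 with h0 | hB
  · omega
  · exact hB

/-- **The THEOREM-V cell `40n < p ≤ 41n`, any `j`**: `v_p(Cas_j(b(n))) ≥ 0 = casLB + 1` — `N_p = 1` (only the block `b₀ − b₆ − b₇ = 43n` reaches `p`), so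
THEOREM V (`padicNorm_coeffV_le_pairFloors`) gives `‖V(b)‖, ‖V(b+e_j)‖ ≤ p` (one better than the cover's `VB = −2`: the two simple-pole classes `[−1,−1]`
at `22n`, `23n` form a conjugate pair), and every row carries `≥ 1` (`checkM_c40` at `B = 1`): `VCarrierAggregate.cas_val_ge_of_coeffV` with `(v, r) = (−1, 1)`. -/
theorem cas_ge_c40 {n j p : ℕ} (hn : 1 ≤ n) (hj1 : 1 ≤ j) (hj7 : j ≤ 7) (hprime : p.Prime) (hA : 40 * n < p) (hB : p ≤ 41 * n)
    (hcas : casoratian (bRay ts3 n) j ≠ 0) :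
    (0 : ℤ) ≤ padicValRat p (casoratian (bRay ts3 n) j) := by
  haveI : Fact p.Prime := ⟨hprime⟩
  have hp2 : p % 2 = 1 := odd_of_prime_gt43 hprime (by omega) hn
  have hp1 : (1 : ℚ) ≤ p := one_le_p
  obtain ⟨hp5, hwin⟩ := window43 hn (show 43 * n < 2 * p by omega)
  have hb := inPolytope_ray n
  have hb' := inPolytope_shift_ts3_j hn j hj1 hj7
  have hwin' : (shift (bRay ts3 n) j 0 + 2 : ℤ) < (p : ℤ) ^ 2 := by rw [BigPrime.shift_zero _ hj1]; exact hwin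
  have hN : pairFloors (bRay ts3 n) p = 1 := N_c40 hA (by omega)
  have hN' : pairFloors (shift (bRay ts3 n) j) p ≤ 1 := hN ▸ pairFloors_shift_le _ hj1 p hprime.pos
  have hVb : padicNorm p (coeffV (bRay ts3 n)) ≤ (p : ℚ) ^ (-(-1 : ℤ)) :=
    (padicNorm_coeffV_le_pairFloors _ hb hp5 hwin).trans (by rw [hN]; norm_num)
  have hVb' : padicNorm p (coeffV (shift (bRay ts3 n) j)) ≤ (p : ℚ) ^ (-(-1 : ℤ)) :=
    (padicNorm_coeffV_le_pairFloors _ hb' hp5 hwin').trans ((zpow_le_zpow_right₀ hp1 hN').trans (by norm_num))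
  have hrows := rows_of_cover (cover_c40 (by omega) (by omega) hp2) (checkM_c40 (decide (¬ (2 : ℤ) ∣ bRay ts3 n 0)))
  have h := cas_val_ge_of_coeffV (bRay ts3 n) hb hj1 hj7 hb' hp5 hwin (-1) 1 hVb hVb' le_rfl hrows
    (fun h => absurd h (by rw [dOf_ts3]; omega)) hcas
  linarith

/-! ## §3 The assembly -/

/-- The (CV) value never exceeds the PATH value: `refund ≤ ⌊d/p⌋ − min([⌊d/p⌋ ≥ 2], C)` for any `C`. -/
theorem refund_le_pathHead (b : ℕ → ℤ) (p : ℕ) (C : ℤ) :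
    refund b p ≤ dOf b / (p : ℤ) - min (if 2 ≤ dOf b / (p : ℤ) then (1 : ℤ) else 0) C := by
  unfold refund
  by_cases h2 : 2 ≤ dOf b / (p : ℤ)
  · rw [if_pos h2]; have := min_le_left (1 : ℤ) C; have := min_le_left (1 : ℤ) (dOf b / (p : ℤ)); omega
  · rw [if_neg h2]; have := min_le_left (0 : ℤ) C; have := min_le_right (1 : ℤ) (dOf b / (p : ℤ)); omega

/-- **`PathAccountingFirstPeriod`'s conclusion ON TOP_STAIR #3 for EVERY prime `p` with `2p > 43n`, every direction `j`, all `n ≥ 1`.** -/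
theorem pathAccounting_ts3 (n j p : ℕ) (hn : 1 ≤ n) (hj1 : 1 ≤ j) (hj7 : j ≤ 7) (hprime : p.Prime) (h43 : 43 * n < 2 * p)
    (hcas : casoratian (bRay ts3 n) j ≠ 0) :
    dOf (bRay ts3 n) / (p : ℤ) - pairFloors (bRay ts3 n) p
        - min (if 2 ≤ dOf (bRay ts3 n) / (p : ℤ) then (1 : ℤ) else 0) (5 - (cStar (bRay ts3 n) p : ℤ))
      ≤ padicValRat p (casoratian (bRay ts3 n) j) := by
  haveI : Fact p.Prime := ⟨hprime⟩
  have hp2 := odd_of_prime_gt43 hprime h43 hn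
  have hLB := cas_ge_casLB hn hj1 hj7 hprime h43 hcas
  have hC11 : (cStar (bRay ts3 n) p : ℤ) ≤ 11 := by exact_mod_cast cStar_le_eleven _ p
  -- ⌊d/p⌋ = 2 : 21.5n < p ≤ 32n
  by_cases hfd2 : p ≤ 32 * n
  · rw [dOf_ts3_div_two (by omega) hfd2, if_pos (le_refl _)]
    have hmin : -6 ≤ min (1 : ℤ) (5 - (cStar (bRay ts3 n) p : ℤ)) := le_min (by norm_num) (by linarith)
    by_cases h : p ≤ 23 * n
    · rw [N_c21 h43 h]; linarith [casLB_c21 (n := n) (p := p) h43 (by omega) hp2]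
    by_cases h' : p ≤ 25 * n
    · rw [N_c23 (by omega) h']; linarith [casLB_c23 (n := n) (p := p) (by omega) (by omega) hp2]
    by_cases h : p ≤ 26 * n
    · have hC : (cStar (bRay ts3 n) p : ℤ) ≤ 10 := by exact_mod_cast cStar_ts3_le_ten (n := n) (p := p) (by omega)
      have hmin' : -5 ≤ min (1 : ℤ) (5 - (cStar (bRay ts3 n) p : ℤ)) := le_min (by norm_num) (by linarith)
      rw [N_c25 (by omega) h]; linarith [casLB_c23 (n := n) (p := p) (by omega) (by omega) hp2]
    by_cases h' : p ≤ 28 * n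
    · have hC : (cStar (bRay ts3 n) p : ℤ) ≤ 9 := by exact_mod_cast cStar_ts3_le_nine (n := n) (p := p) (by omega)
      have hmin' : -4 ≤ min (1 : ℤ) (5 - (cStar (bRay ts3 n) p : ℤ)) := le_min (by norm_num) (by linarith)
      rw [N_c26 (by omega) h']; linarith [casLB_c23 (n := n) (p := p) (by omega) (by omega) hp2]
    have hC8 : (cStar (bRay ts3 n) p : ℤ) ≤ 8 := by exact_mod_cast cStar_ts3_le_eight (n := n) (p := p) (by omega)
    have hmin8 : -3 ≤ min (1 : ℤ) (5 - (cStar (bRay ts3 n) p : ℤ)) := le_min (by norm_num) (by linarith)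
    by_cases h : 3 * p ≤ 85 * n
    · rw [N_c28 (by omega) (by omega)]; linarith [casLB_c28a (n := n) (p := p) (by omega) h hp2]
    by_cases h' : p ≤ 30 * n
    · rw [N_c28 (by omega) h']; linarith [cas_ge_c28b hn hj1 hj7 hprime (by omega) h' hcas]
    have hC6 : (cStar (bRay ts3 n) p : ℤ) ≤ 6 := by exact_mod_cast cStar_ts3_le_six (n := n) (p := p) (by omega)
    have hmin6 : -1 ≤ min (1 : ℤ) (5 - (cStar (bRay ts3 n) p : ℤ)) := le_min (by norm_num) (by linarith)
    by_cases h : p ≤ 31 * n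
    · rw [N_c30 (by omega) h]; linarith [cas_ge_c30 hn hj1 hj7 hprime (by omega) h hcas]
    · rw [N_c31 (by omega) (by omega)]; linarith [cas_ge_c31 hn hj1 hj7 hprime (by omega) hfd2 hcas]
  push Not at hfd2
  -- ⌊d/p⌋ = 1 : 32n < p ≤ 64n
  have hC5 : (cStar (bRay ts3 n) p : ℤ) ≤ 5 := by exact_mod_cast cStar_ts3_le_five (n := n) (p := p) (by omega)
  have hmin0 : (0 : ℤ) ≤ min (0 : ℤ) (5 - (cStar (bRay ts3 n) p : ℤ)) := le_min le_rfl (by linarith)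
  by_cases hfd1 : p ≤ 64 * n
  · rw [dOf_ts3_div_one hfd2 hfd1, if_neg (by norm_num)]
    by_cases h : p ≤ 33 * n
    · rw [N_c31 (by omega) h]; linarith [casLB_c32 (n := n) (p := p) (by omega) (by omega) hp2]
    by_cases h' : p ≤ 35 * n
    · rw [N_c33 (by omega) h']; linarith [casLB_c33 (n := n) (p := p) (by omega) (by omega) hp2]
    by_cases h : p ≤ 36 * n
    · rw [N_c35 (by omega) h]; linarith [cas_ge_c35 hn hj1 hj7 hprime (by omega) h hcas]
    by_cases h' : p ≤ 38 * n
    · rw [N_c36 (by omega) h']; linarith [casLB_c36 (n := n) (p := p) (by omega) (by omega) hp2]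
    by_cases h : p ≤ 40 * n
    · rw [N_c38 (by omega) h]; linarith [casLB_c38 (n := n) (p := p) (by omega) (by omega) hp2]
    by_cases h' : p ≤ 41 * n
    · rw [N_c40 (by omega) (by omega)]; linarith [cas_ge_c40 hn hj1 hj7 hprime (by omega) h' hcas]
    by_cases h : p ≤ 43 * n
    · rw [N_c40 (by omega) h]; linarith [casLB_c41 (n := n) (p := p) (by omega) (by omega) hp2]
    · rw [N_gt43 (by omega)]; linarith [casLB_c43 (n := n) (p := p) (by omega) (by omega) hp2]
  push Not at hfd1
  -- ⌊d/p⌋ = 0 : p > 64n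
  rw [dOf_ts3_div_zero hfd1, if_neg (by norm_num), N_gt43 (by omega)]
  by_cases h85 : 85 * n < p
  · have hcv := casoratianValuationLaw_above (bRay ts3 n) j p (inPolytope_ray n) hj1 hj7
      (inPolytope_shift_ts3_j hn j hj1 hj7) hprime (by omega) (by rw [w0]; exact_mod_cast (show 85 * n + 1 ≤ p by omega)) hcas
    rw [refund_ts3_zero (by omega), N_gt43 (by omega)] at hcv
    linarith
  · linarith [casLB_c64 (n := n) (p := p) (by omega) (by omega) hp2]

/-- On TOP_STAIR #3 the node's hypothesis `FirstPeriod` forces `43n < 2p` (the pair block `85n − 22n − 20n = 43n` is `< 2p`). -/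
theorem fortythree_lt_of_firstPeriod {n p : ℕ} (h : FirstPeriod (bRay ts3 n) p) : 43 * n < 2 * p := by
  have := h.2 5 (by simp) 6 (by simp) (by norm_num)
  simp only [Nat.reduceAdd, w0, w6, w7] at this
  have h' : (43 * n : ℤ) < 2 * p := by linarith
  exact_mod_cast h'

/-- **`PathAccountingFirstPeriod` ON TOP_STAIR #3 in the node's own hypotheses** (`FirstPeriod (b(n)) p`), every `j`, all `n ≥ 1`. -/
theorem pathAccountingFirstPeriod_ts3 (n j p : ℕ) (hn : 1 ≤ n) (hj1 : 1 ≤ j) (hj7 : j ≤ 7) (hprime : p.Prime)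
    (hfp : FirstPeriod (bRay ts3 n) p) (hcas : casoratian (bRay ts3 n) j ≠ 0) :
    dOf (bRay ts3 n) / (p : ℤ) - pairFloors (bRay ts3 n) p
        - min (if 2 ≤ dOf (bRay ts3 n) / (p : ℤ) then (1 : ℤ) else 0) (5 - (cStar (bRay ts3 n) p : ℤ))
      ≤ padicValRat p (casoratian (bRay ts3 n) j) :=
  pathAccounting_ts3 n j p hn hj1 hj7 hprime (fortythree_lt_of_firstPeriod hfp) hcas

/-- **The node `PathAccountingFirstPeriod` restricted to TOP_STAIR #3**, literally (all its binders, `b := b(n)`), all `n ≥ 1`. -/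
theorem pathAccountingFirstPeriod_on_ts3 (n p : ℕ) (hn : 1 ≤ n) :
    InPolytope (bRay ts3 n) → Sorted7 (bRay ts3 n) → InPolytope (shift (bRay ts3 n) 7) → p.Prime → 5 ≤ p →
    (bRay ts3 n 0 + 2 : ℤ) < (p : ℤ) ^ 2 → FirstPeriod (bRay ts3 n) p → casoratian (bRay ts3 n) 7 ≠ 0 →
      dOf (bRay ts3 n) / (p : ℤ) - pairFloors (bRay ts3 n) p
          - min (if 2 ≤ dOf (bRay ts3 n) / (p : ℤ) then (1 : ℤ) else 0) (5 - (cStar (bRay ts3 n) p : ℤ))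
        ≤ padicValRat p (casoratian (bRay ts3 n) 7) :=
  fun _ _ _ hprime _ _ hfp hcas => pathAccountingFirstPeriod_ts3 n 7 p hn (by norm_num) (by norm_num) hprime hfp hcas

/-- **(CV) on the first-period TOP_STAIR #3 ray, every direction `j`, all `n`** (a corollary: the (CV) value never exceeds the PATH value):
for `n ≥ 1`, `1 ≤ j ≤ 7`, every prime `p` with `43n < 2p` and `Cas_j(b(n)) ≠ 0`, `refund − N_p ≤ v_p(Cas_j(b(n)))`. -/
theorem ts3RayCV_gt43 (n j p : ℕ) (hn : 1 ≤ n) (hj1 : 1 ≤ j) (hj7 : j ≤ 7) (hprime : p.Prime) (h43 : 43 * n < 2 * p)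
    (hcas : casoratian (bRay ts3 n) j ≠ 0) :
    refund (bRay ts3 n) p - pairFloors (bRay ts3 n) p ≤ padicValRat p (casoratian (bRay ts3 n) j) := by
  linarith [refund_le_pathHead (bRay ts3 n) p (5 - (cStar (bRay ts3 n) p : ℤ)), pathAccounting_ts3 n j p hn hj1 hj7 hprime h43 hcas]

/-- **PATH = STAIR on the two staircase cells, for the record** (every `j`, all `n`, closed windows): `v_p(Cas_j(b(n))) ≥ −3` on `36n < p ≤ 38n`
(BZ's levels `m₂ = m₃ = 38` vs STAIR's; the node's value `1 − 4 − 0`) and `≥ −4` on `35n < p ≤ 36n` (Lemma D; node value `1 − 5`); the tree's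
`StairCellTS3a/b` are the open windows for `j = 7`. -/
theorem stairCells_ts3 (n j p : ℕ) (hn : 1 ≤ n) (hj1 : 1 ≤ j) (hj7 : j ≤ 7) (hprime : p.Prime) (hcas : casoratian (bRay ts3 n) j ≠ 0) :
    (36 * n < p → p ≤ 38 * n → (-3 : ℤ) ≤ padicValRat p (casoratian (bRay ts3 n) j)) ∧
    (35 * n < p → p ≤ 36 * n → (-4 : ℤ) ≤ padicValRat p (casoratian (bRay ts3 n) j)) := by
  haveI : Fact p.Prime := ⟨hprime⟩
  refine ⟨fun hA hB => ?_, fun hA hB => cas_ge_c35 hn hj1 hj7 hprime hA hB hcas⟩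
  exact (casLB_c36 (by omega) (by omega) (odd_of_prime_gt43 hprime (by omega) hn)).trans (cas_ge_casLB hn hj1 hj7 hprime (by omega) hcas)

end Summit.KontsevichZagierPeriods.Zeta5Search.StairTS3
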